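import Literature.Probability.RandomPlanarGeometry.SAWCountZdRepeatSetShapes
import HarnessLib

/-!
# SYMBOL POLYNOMIALITY: the `1/d`-symbols of `c_n(ℤ^d)` are finite shape sums — the bad-word count `T_j(n)` is `2^n` times a polynomial in `n` (`n ≥ 2j − 1`)

Topic `Literature/Probability/RandomPlanarGeometry` (completes the lane's «SYMBOL POLYNOMIALITY» programme on top of `SAWCountZdRepeatSetShapes.lean`
(a-p1 g22: the repeat set `repSet`, the adjacency vector `adjVec`, and ★ `card_fibre : #fibre_j(U) = #shapeClass_j(|U|, A_U) · 2^{n−|U|}`);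
tools from `SAWCountZdPlantedPatternCounts.lean` (a-p1 g21) and a-p3 g18's type calculus `SAWPulledLargeForceExpansionZdWordTypes.lean`).

PRINTED CONTEXT (locators only; nothing is quoted digit-for-digit). Madras–Slade (1993) §1.1 eq. (1.1.8) p. 5 (the `1/d` expansion of `μ`, after
Fisher–Sykes / Fisher–Gaunt, "although there is no rigorous control of their error term"), Definition 1.2.4; Clisby–Liang–Slade (2007) §3.3 eqs.
(29)/(31) (decomposition of an enumeration by the number of dimensions explored, canonical orientation, factor `α_d(δ)`); Nemirovsky–Freed–
Ishinabe–Douglas (1992) claim an "exact analytic form" of `C_n` in `(n, d)` (abstract only; text not held). NOT IN PRINT as far as the lane's desks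
could locate (lit-1 g30 / lit-2 g31, 2026-08-27): the statements below.

THE THEOREM. Let `T_j(n)` (`badSlice j n`) be the canonical reversal-free step words of length `n` with `n − j` axes and a repeat — the count whose
`j = 3` instance is `WordTypes.card_badCanonical` (CAR M, the fourth coefficient of `c_n(ℤ^d)`) and whose `j = 4` instance is what the memory-2 assembly
needs for the fifth. THEN ★★★ `card_badSlice_eq_pow_mul_eval`: for every `j` and every `n` with `2j ≤ n + 1`,
`#T_j(n) = 2^n · R_j(n)` with `R_j = symbolPoly j ∈ ℚ[X]` EXPLICIT — `R_j(X) = Σ_{u ≤ 2j} Σ_{A valid} #shapeClass_j(u, A) · 2^{−u} · C(X + 1 − u, breaks A)`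
— of degree `≤ 2j` (`natDegree_symbolPoly_le`); `exists_polynomial_card_badSlice` is the existential form and `card_canonical_bad_eq_pow_mul_eval` the
form with `n = l + j`, `numAxes = l` used by `SAWCountZdBadWordTypes`. MECHANISM: `#T_j(n) = Σ_U #fibre_j(U)` (`card_badSlice_eq_sum_fibre`); fibres with
`|U| > 2j` are empty (`card_fibre_eq_zero_of_lt`, via `#repSet ≤ 2(n − numAxes)`); `#fibre_j(U)` depends on `U` only through `(|U|, A_U)` (`card_fibre`);
and ★★★ THE SLOT COUNT `card_filter_adjVec_eq_choose`: the `u`-sets of positions of `Fin n` with a given adjacency vector `A` (last entry a break)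
number `C(n + 1 − u, breaks A)` — a bijection (`placeSet`, `placeSet_injective`, `exists_placeSet_eq`) with the `breaks A`-subsets of the
`n + 1 − u` SLOTS around the `n − u` free positions (run `r` of `U` sits in slot `s_r`; position `i` of `U` lands at `s_{runIdx i} + i`). So the
symbol census is a FINITE computation for every `j`: `R_j` is determined by the finitely many shape-class cardinalities `#shapeClass_j(u, A)`,
`u ≤ 2j` (FINDING-ZD-SYMBOL-POLYNOMIALITY §3: 37 shapes for `j = 3` reproduce CAR M's cubic; 1 798 shapes for `j = 4` reproduce the (L1′) quintic).

THIS FILE (lane «pcv-sawmu», a-p1 g22; all PROVED, standard axioms; tool notions `breaks`, `runIdx`, `place`, `placeSet`, `gap`, `badSlice`, `AdjValid`,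
`slotCount`, `symbolPoly` — not notions in print):
* runs and slots: `runIdx_mono`, `runIdx_succ`, `runIdx_zero`, `runIdx_le`, `runIdx_lt_breaks`, `runIdx_last`, `exists_runIdx_eq`; `place_strictMono`,
  ★ `place_succ_eq_iff`, `place_lt`, `card_placeSet`, `orderEmbOfFin_placeSet`, ★ `adjVec_placeSet`, ★ `placeSet_injective`; `le_orderEmbOfFin_val`,
  `orderEmbOfFin_val_add_le`, `orderEmbOfFin_val_eq_gap_add`, `gap_succ`, `gap_mono`, `gap_lt_of_break`, ★ `break_lt_iff` (rank lemma),
  ★ `gap_eq_gap_break`, ★★ `exists_placeSet_eq` (surjectivity), ★★★ `card_filter_adjVec_eq_choose`;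
* assembly: `slotCount_eq`, `slotCount_eq_zero_of_lt`, `badSlice_filter_repSet`, `card_badSlice_eq_sum_fibre`, `shapeClass_eq_empty` (`u > 2j`),
  `card_fibre_eq_zero_of_lt`, ★★ `card_badSlice_eq_sum` (the regrouped count), `breaks_pos_of_valid`, `breaks_le`, `eval_symbolPoly_term`,
  ★★★ `card_badSlice_eq_pow_mul_eval`, ★★★ `card_canonical_bad_eq_pow_mul_eval`, `natDegree_symbolPoly_le`, ★★★ `exists_polynomial_card_badSlice`.
[cite: MadrasSlade1993, §1.1 eq. (1.1.8) p. 5; Definition 1.2.4; §1.2 (p. 10)] [cite: ClisbyLiangSlade2007, §3.3 eqs. (29)/(31)]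

Provenance: lane «pcv-sawmu», a-p1 g22 (2026-08-27).
-/

noncomputable section

open Finset
open scoped BigOperators
open Literature.Probability.LatticeModels
open Literature.Probability.RandomPlanarGeometry.SAW
open Literature.Probability.Percolation

namespace Literature.Probability.RandomPlanarGeometry.SAW.Zd

namespace WordTypes

variable {n D : ℕ}


/-! ## α-III: SLOTS — the position sets with a given adjacency vector number `C(n + 1 − u, #runs)` -/

section Slots

variable {u : ℕ}

/-- The number of run breaks of an adjacency vector: entries `false` (the last entry included). [cite: MadrasSlade1993, Definition 1.2.4; lane tool notion] -/
def breaks (A : Fin u → Bool) : ℕ := (Finset.univ.filter fun k : Fin u => A k = false).card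

/-- The run index of position `i`: the number of breaks strictly before `i`. [cite: MadrasSlade1993, Definition 1.2.4; lane tool notion] -/
def runIdx (A : Fin u → Bool) (i : Fin u) : ℕ := (Finset.univ.filter fun k : Fin u => k < i ∧ A k = false).card

/-- The run index is monotone. [cite: MadrasSlade1993, Definition 1.2.4; lane plumbing] -/
theorem runIdx_mono (A : Fin u → Bool) {i i' : Fin u} (h : i ≤ i') : runIdx A i ≤ runIdx A i' := by
  unfold runIdx
  exact Finset.card_le_card fun k hk => by
    rw [Finset.mem_filter] at hk ⊢
    exact ⟨hk.1, lt_of_lt_of_le hk.2.1 h, hk.2.2⟩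

/-- One step of the run index: it increases by one exactly at a break. [cite: MadrasSlade1993, Definition 1.2.4; lane plumbing] -/
theorem runIdx_succ (A : Fin u → Bool) (i : Fin u) (hi : i.val + 1 < u) :
    runIdx A ⟨i.val + 1, hi⟩ = runIdx A i + (if A i = false then 1 else 0) := by
  classical
  unfold runIdx
  have hsplit : (Finset.univ.filter fun k : Fin u => k < (⟨i.val + 1, hi⟩ : Fin u) ∧ A k = false) =
      (Finset.univ.filter fun k : Fin u => k < i ∧ A k = false) ∪ (if A i = false then {i} else ∅) := by
    ext k
    simp only [Finset.mem_filter, Finset.mem_univ, true_and, Finset.mem_union]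
    constructor
    · rintro ⟨hk, hA⟩
      have hk' : k.val < i.val + 1 := hk
      by_cases hki : k = i
      · subst hki; right; simp [hA]
      · left
        refine ⟨?_, hA⟩
        have : k.val ≠ i.val := fun h => hki (Fin.ext h)
        change k.val < i.val
        omega
    · rintro (⟨hk, hA⟩ | hk)
      · exact ⟨lt_trans hk (Fin.mk_lt_mk.2 (by simp)), hA⟩
      · split_ifs at hk with hA
        · simp only [Finset.mem_singleton] at hk
          subst hk
          exact ⟨Fin.mk_lt_mk.2 (by simp), hA⟩
        · simp at hk
  rw [hsplit, Finset.card_union_of_disjoint]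
  · split_ifs <;> simp
  · split_ifs with hA
    · rw [Finset.disjoint_singleton_right, Finset.mem_filter]
      exact fun h => lt_irrefl _ h.2.1
    · exact Finset.disjoint_empty_right _

/-- The run index at position `0` is `0`. [cite: MadrasSlade1993, Definition 1.2.4; lane plumbing] -/
theorem runIdx_zero (A : Fin u → Bool) (h : 0 < u) : runIdx A ⟨0, h⟩ = 0 := by
  unfold runIdx
  rw [Finset.card_eq_zero, Finset.filter_eq_empty_iff]
  rintro k - ⟨hk, -⟩
  exact absurd hk (Nat.not_lt_zero _)

/-- The run index is at most the position. [cite: MadrasSlade1993, Definition 1.2.4; lane plumbing] -/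
theorem runIdx_le (A : Fin u → Bool) (i : Fin u) : runIdx A i ≤ i.val := by
  unfold runIdx
  calc (Finset.univ.filter fun k : Fin u => k < i ∧ A k = false).card
      ≤ (Finset.Iio i).card :=
        Finset.card_le_card fun k hk => by rw [Finset.mem_filter] at hk; exact Finset.mem_Iio.2 hk.2.1
    _ = i.val := Fin.card_Iio i

/-- With a break at the last position, every run index is `< breaks A`. [cite: MadrasSlade1993, Definition 1.2.4; lane plumbing] -/
theorem runIdx_lt_breaks (A : Fin u → Bool) (hlast : ∀ h : 0 < u, A ⟨u - 1, by omega⟩ = false) (i : Fin u) : runIdx A i < breaks A := by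
  have hu : 0 < u := lt_of_le_of_lt (Nat.zero_le _) i.isLt
  have hi := i.isLt
  unfold runIdx breaks
  apply Finset.card_lt_card
  refine (Finset.ssubset_iff_of_subset fun k hk => ?_).2 ⟨⟨u - 1, by omega⟩, ?_, ?_⟩
  · rw [Finset.mem_filter] at hk ⊢; exact ⟨hk.1, hk.2.2⟩
  · rw [Finset.mem_filter]; exact ⟨Finset.mem_univ _, hlast hu⟩
  · rw [Finset.mem_filter]; rintro ⟨-, hlt, -⟩
    have : u - 1 < i.val := hlt
    omega

/-! ### Placing runs into slots -/

/-- The PLACEMENT of position `i` for slot set `S`: the `runIdx A i`-th smallest slot plus `i`. [cite: MadrasSlade1993, Definition 1.2.4; lane tool notion] -/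
def place (A : Fin u → Bool) (hlast : ∀ h : 0 < u, A ⟨u - 1, by omega⟩ = false) (S : Finset ℕ) (hS : S.card = breaks A) (i : Fin u) : ℕ :=
  S.orderEmbOfFin hS ⟨runIdx A i, runIdx_lt_breaks A hlast i⟩ + i.val

/-- The placement is strictly increasing. [cite: MadrasSlade1993, Definition 1.2.4; lane plumbing] -/
theorem place_strictMono (A : Fin u → Bool) (hlast : ∀ h : 0 < u, A ⟨u - 1, by omega⟩ = false) (S : Finset ℕ) (hS : S.card = breaks A) :
    StrictMono (place A hlast S hS) := by
  intro i i' h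
  unfold place
  have hmono : S.orderEmbOfFin hS ⟨runIdx A i, runIdx_lt_breaks A hlast i⟩ ≤ S.orderEmbOfFin hS ⟨runIdx A i', runIdx_lt_breaks A hlast i'⟩ :=
    (S.orderEmbOfFin hS).monotone (Fin.mk_le_mk.2 (runIdx_mono A h.le))
  have h' : i.val < i'.val := h
  omega

/-- ★ Consecutive placements iff no break: `place (i+1) = place i + 1 ↔ A i`. [cite: MadrasSlade1993, Definition 1.2.4; lane lemma] -/
theorem place_succ_eq_iff (A : Fin u → Bool) (hlast : ∀ h : 0 < u, A ⟨u - 1, by omega⟩ = false) (S : Finset ℕ) (hS : S.card = breaks A)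
    (i : Fin u) (hi : i.val + 1 < u) :
    place A hlast S hS ⟨i.val + 1, hi⟩ = place A hlast S hS i + 1 ↔ A i = true := by
  unfold place
  have hr := runIdx_succ A i hi
  by_cases hA : A i = false
  · rw [hA, if_pos rfl] at hr
    have hlt : S.orderEmbOfFin hS ⟨runIdx A i, runIdx_lt_breaks A hlast i⟩ <
        S.orderEmbOfFin hS ⟨runIdx A ⟨i.val + 1, hi⟩, runIdx_lt_breaks A hlast _⟩ :=
      (S.orderEmbOfFin hS).strictMono (Fin.mk_lt_mk.2 (by omega))
    simp only [hA, Bool.false_eq_true, iff_false]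
    change S.orderEmbOfFin hS ⟨runIdx A ⟨i.val + 1, hi⟩, _⟩ + (i.val + 1) ≠ _
    omega
  · rw [if_neg hA] at hr
    simp only [Bool.not_eq_false] at hA
    simp only [hA, iff_true]
    have heq : (⟨runIdx A ⟨i.val + 1, hi⟩, runIdx_lt_breaks A hlast _⟩ : Fin (breaks A)) = ⟨runIdx A i, runIdx_lt_breaks A hlast i⟩ :=
      Fin.ext (by simp [hr])
    change S.orderEmbOfFin hS ⟨runIdx A ⟨i.val + 1, hi⟩, _⟩ + (i.val + 1) = _
    rw [heq]
    ring

/-- The placement stays inside a word of length `n` when the slots are `< n + 1 − u`. [cite: MadrasSlade1993, Definition 1.2.4; lane plumbing] -/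
theorem place_lt (A : Fin u → Bool) (hlast : ∀ h : 0 < u, A ⟨u - 1, by omega⟩ = false) (S : Finset ℕ) (hS : S.card = breaks A)
    (hsub : S ⊆ Finset.range (n + 1 - u)) (i : Fin u) : place A hlast S hS i < n := by
  unfold place
  have hmem := hsub (Finset.orderEmbOfFin_mem S hS ⟨runIdx A i, runIdx_lt_breaks A hlast i⟩)
  rw [Finset.mem_range] at hmem
  have := i.isLt
  omega

/-- The PLACED SET: the image of the placement, a `u`-set of positions of `Fin n`. [cite: MadrasSlade1993, Definition 1.2.4; lane tool notion] -/
def placeSet (A : Fin u → Bool) (hlast : ∀ h : 0 < u, A ⟨u - 1, by omega⟩ = false) (S : Finset ℕ) (hS : S.card = breaks A)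
    (hsub : S ⊆ Finset.range (n + 1 - u)) : Finset (Fin n) :=
  Finset.univ.image fun i : Fin u => (⟨place A hlast S hS i, place_lt A hlast S hS hsub i⟩ : Fin n)

/-- The placed set has `u` members. [cite: MadrasSlade1993, Definition 1.2.4; lane plumbing] -/
theorem card_placeSet (A : Fin u → Bool) (hlast : ∀ h : 0 < u, A ⟨u - 1, by omega⟩ = false) (S : Finset ℕ) (hS : S.card = breaks A)
    (hsub : S ⊆ Finset.range (n + 1 - u)) : (placeSet A hlast S hS hsub).card = u := by
  unfold placeSet
  rw [Finset.card_image_of_injective, Finset.card_univ, Fintype.card_fin]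
  intro i i' h
  exact (place_strictMono A hlast S hS).injective (congrArg Fin.val h)

/-- The increasing enumeration of the placed set is the placement. [cite: MadrasSlade1993, Definition 1.2.4; lane plumbing] -/
theorem orderEmbOfFin_placeSet (A : Fin u → Bool) (hlast : ∀ h : 0 < u, A ⟨u - 1, by omega⟩ = false) (S : Finset ℕ) (hS : S.card = breaks A)
    (hsub : S ⊆ Finset.range (n + 1 - u)) (i : Fin u) :
    (placeSet A hlast S hS hsub).orderEmbOfFin (card_placeSet A hlast S hS hsub) i = ⟨place A hlast S hS i, place_lt A hlast S hS hsub i⟩ := by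
  have h := Finset.orderEmbOfFin_unique (card_placeSet A hlast S hS hsub)
    (f := fun i : Fin u => (⟨place A hlast S hS i, place_lt A hlast S hS hsub i⟩ : Fin n))
    (fun i => by unfold placeSet; exact Finset.mem_image.2 ⟨i, Finset.mem_univ _, rfl⟩)
    (fun i i' hii' => place_strictMono A hlast S hS hii')
  exact (congrFun h i).symm

/-- ★ The placed set has adjacency vector `A`. [cite: MadrasSlade1993, Definition 1.2.4; lane lemma] -/
theorem adjVec_placeSet (A : Fin u → Bool) (hlast : ∀ h : 0 < u, A ⟨u - 1, by omega⟩ = false) (S : Finset ℕ) (hS : S.card = breaks A)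
    (hsub : S ⊆ Finset.range (n + 1 - u)) : adjVec (placeSet A hlast S hS hsub) (card_placeSet A hlast S hS hsub) = A := by
  funext i
  by_cases hi : i.val + 1 < u
  · rw [Bool.eq_iff_iff, adjVec_eq_true_iff _ _ i hi, orderEmbOfFin_placeSet, orderEmbOfFin_placeSet]
    exact place_succ_eq_iff A hlast S hS i hi
  · rw [adjVec_eq_false_of_last _ _ i hi]
    have : i = ⟨u - 1, by omega⟩ := Fin.ext (by simp; omega)
    rw [this, hlast (by omega)]

/-! ### Injectivity of the placement in the slot set -/

/-- The run index at the last position is `breaks A − 1`. [cite: MadrasSlade1993, Definition 1.2.4; lane plumbing] -/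
theorem runIdx_last (A : Fin u → Bool) (hu : 0 < u) (hlast : ∀ h : 0 < u, A ⟨u - 1, by omega⟩ = false) :
    runIdx A ⟨u - 1, by omega⟩ + 1 = breaks A := by
  classical
  unfold runIdx breaks
  have hsplit : (Finset.univ.filter fun k : Fin u => A k = false) =
      (Finset.univ.filter fun k : Fin u => k < (⟨u - 1, by omega⟩ : Fin u) ∧ A k = false) ∪ {⟨u - 1, by omega⟩} := by
    ext k
    simp only [Finset.mem_filter, Finset.mem_univ, true_and, Finset.mem_union, Finset.mem_singleton]
    constructor
    · intro hA
      by_cases hk : k = ⟨u - 1, by omega⟩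
      · exact Or.inr hk
      · refine Or.inl ⟨?_, hA⟩
        have : k.val ≠ u - 1 := fun h => hk (Fin.ext h)
        have := k.isLt
        change k.val < u - 1
        omega
    · rintro (⟨-, hA⟩ | rfl)
      · exact hA
      · exact hlast hu
  rw [hsplit, Finset.card_union_of_disjoint, Finset.card_singleton]
  rw [Finset.disjoint_singleton_right, Finset.mem_filter]
  exact fun h => lt_irrefl _ h.2.1

/-- Every run index value below `breaks A` is attained (the run index climbs by steps of at most one).
[cite: MadrasSlade1993, Definition 1.2.4; lane plumbing] -/
theorem exists_runIdx_eq (A : Fin u → Bool) (hlast : ∀ h : 0 < u, A ⟨u - 1, by omega⟩ = false) {r : ℕ} (hr : r < breaks A) :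
    ∃ i : Fin u, runIdx A i = r := by
  -- all values `≤ runIdx A i` are attained at positions `≤ i`
  have climb : ∀ m : ℕ, ∀ hm : m < u, ∀ r ≤ runIdx A ⟨m, hm⟩, ∃ i : Fin u, runIdx A i = r := by
    intro m
    induction m with
    | zero => intro hm r hr; rw [runIdx_zero A hm] at hr; exact ⟨⟨0, hm⟩, by rw [runIdx_zero A hm]; omega⟩
    | succ m ih =>
      intro hm r hr
      have hstep := runIdx_succ A ⟨m, by omega⟩ hm
      by_cases hle : r ≤ runIdx A ⟨m, by omega⟩
      · exact ih (by omega) r hle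
      · refine ⟨⟨m + 1, hm⟩, ?_⟩
        have : runIdx A ⟨m + 1, hm⟩ ≤ runIdx A ⟨m, by omega⟩ + 1 := by rw [hstep]; split_ifs <;> omega
        change runIdx A ⟨m + 1, hm⟩ = r
        omega
  have hu : 0 < u := by
    by_contra h
    have hu0 : u = 0 := by omega
    subst hu0
    unfold breaks at hr
    simp at hr
  have hl := runIdx_last A hu hlast
  exact climb (u - 1) (by omega) r (by omega)

/-- ★ The placed set determines the slot set. [cite: MadrasSlade1993, Definition 1.2.4; lane lemma] -/
theorem placeSet_injective (A : Fin u → Bool) (hlast : ∀ h : 0 < u, A ⟨u - 1, by omega⟩ = false) {S S' : Finset ℕ} (hS : S.card = breaks A)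
    (hS' : S'.card = breaks A) (hsub : S ⊆ Finset.range (n + 1 - u)) (hsub' : S' ⊆ Finset.range (n + 1 - u))
    (h : placeSet A hlast S hS hsub = placeSet A hlast S' hS' hsub') : S = S' := by
  -- the two placements coincide
  have hplace : ∀ i, place A hlast S hS i = place A hlast S' hS' i := by
    intro i
    have huniq := Finset.orderEmbOfFin_unique (card_placeSet A hlast S' hS' hsub')
      (f := fun i : Fin u => (⟨place A hlast S hS i, place_lt A hlast S hS hsub i⟩ : Fin n))
      (fun i => by rw [← h]; unfold placeSet; exact Finset.mem_image.2 ⟨i, Finset.mem_univ _, rfl⟩)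
      (fun i i' hii' => place_strictMono A hlast S hS hii')
    have := congrFun huniq i
    rw [orderEmbOfFin_placeSet] at this
    exact congrArg Fin.val this
  -- hence the two slot enumerations coincide at every run index, i.e. everywhere
  have hslots : ∀ r : Fin (breaks A), S.orderEmbOfFin hS r = S'.orderEmbOfFin hS' r := by
    intro r
    obtain ⟨i, hi⟩ := exists_runIdx_eq A hlast r.isLt
    have hp := hplace i
    unfold place at hp
    have hr : (⟨runIdx A i, runIdx_lt_breaks A hlast i⟩ : Fin (breaks A)) = r := Fin.ext hi
    rw [hr] at hp
    omega
  rw [← Finset.coe_inj, ← Finset.range_orderEmbOfFin S hS, ← Finset.range_orderEmbOfFin S' hS']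
  congr 1
  ext r : 1
  exact hslots r

/-! ### Surjectivity of the placement: every position set is placed from its slot set -/

/-- Members of a `u`-set sit at positions at least their index. [cite: MadrasSlade1993, Definition 1.2.4; lane plumbing] -/
theorem le_orderEmbOfFin_val (U : Finset (Fin n)) (hU : U.card = u) : ∀ i : Fin u, i.val ≤ (U.orderEmbOfFin hU i).val := by
  have key : ∀ m : ℕ, ∀ hm : m < u, m ≤ (U.orderEmbOfFin hU ⟨m, hm⟩).val := by
    intro m
    induction m with
    | zero => intro _; exact Nat.zero_le _
    | succ m ih =>
      intro hm
      have h1 := ih (by omega)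
      have hlt : U.orderEmbOfFin hU ⟨m, by omega⟩ < U.orderEmbOfFin hU ⟨m + 1, hm⟩ := (U.orderEmbOfFin hU).strictMono (Fin.mk_lt_mk.2 (by omega))
      have hlt' : (U.orderEmbOfFin hU ⟨m, by omega⟩).val < (U.orderEmbOfFin hU ⟨m + 1, hm⟩).val := hlt
      omega
  intro i
  exact key i.val i.isLt

/-- Members of a `u`-set leave room for the later members: `e i + (u − 1 − i) ≤ n − 1`. [cite: MadrasSlade1993, Definition 1.2.4; lane plumbing] -/
theorem orderEmbOfFin_val_add_le (U : Finset (Fin n)) (hU : U.card = u) (i : Fin u) : (U.orderEmbOfFin hU i).val + (u - 1 - i.val) ≤ n - 1 := by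
  -- by downward induction: compare with the last member
  have key : ∀ m : ℕ, ∀ hm : i.val + m < u, (U.orderEmbOfFin hU i).val + m ≤ (U.orderEmbOfFin hU ⟨i.val + m, hm⟩).val := by
    intro m
    induction m with
    | zero => intro hm; simp
    | succ m ih =>
      intro hm
      have h1 := ih (by omega)
      have hlt : U.orderEmbOfFin hU ⟨i.val + m, by omega⟩ < U.orderEmbOfFin hU ⟨i.val + (m + 1), hm⟩ :=
        (U.orderEmbOfFin hU).strictMono (Fin.mk_lt_mk.2 (by omega))
      have hlt' : (U.orderEmbOfFin hU ⟨i.val + m, by omega⟩).val < (U.orderEmbOfFin hU ⟨i.val + (m + 1), hm⟩).val := hlt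
      omega
  have h := key (u - 1 - i.val) (by omega)
  have hlt := (U.orderEmbOfFin hU ⟨i.val + (u - 1 - i.val), by omega⟩).isLt
  omega

/-- The GAP function of a position set: `g i = e i − i` (number of free positions before the `i`-th member).
[cite: MadrasSlade1993, Definition 1.2.4; lane tool notion] -/
def gap (U : Finset (Fin n)) (hU : U.card = u) (i : Fin u) : ℕ := (U.orderEmbOfFin hU i).val - i.val

/-- `e i = gap i + i`. [cite: MadrasSlade1993, Definition 1.2.4; lane plumbing] -/
theorem orderEmbOfFin_val_eq_gap_add (U : Finset (Fin n)) (hU : U.card = u) (i : Fin u) : (U.orderEmbOfFin hU i).val = gap U hU i + i.val := by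
  unfold gap; have := le_orderEmbOfFin_val U hU i; omega

/-- One step of the gap function: constant across an adjacent pair, increasing across a break. [cite: MadrasSlade1993, Definition 1.2.4; lane plumbing] -/
theorem gap_succ (U : Finset (Fin n)) (hU : U.card = u) (i : Fin u) (hi : i.val + 1 < u) :
    (adjVec U hU i = true → gap U hU ⟨i.val + 1, hi⟩ = gap U hU i) ∧ (adjVec U hU i = false → gap U hU i + 1 ≤ gap U hU ⟨i.val + 1, hi⟩) := by
  have h0 := orderEmbOfFin_val_eq_gap_add U hU i
  have h1 := orderEmbOfFin_val_eq_gap_add U hU ⟨i.val + 1, hi⟩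
  have hlt : U.orderEmbOfFin hU i < U.orderEmbOfFin hU ⟨i.val + 1, hi⟩ := (U.orderEmbOfFin hU).strictMono (Fin.mk_lt_mk.2 (by simp))
  have hlt' : (U.orderEmbOfFin hU i).val < (U.orderEmbOfFin hU ⟨i.val + 1, hi⟩).val := hlt
  have hiff := adjVec_eq_true_iff U hU i hi
  constructor
  · intro hA
    have := hiff.1 hA
    simp only at h1
    omega
  · intro hA
    have hne : (U.orderEmbOfFin hU ⟨i.val + 1, hi⟩).val ≠ (U.orderEmbOfFin hU i).val + 1 := fun h => by
      rw [hiff.2 h] at hA; exact Bool.noConfusion hA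
    simp only at h1
    omega

/-- The gap function is monotone. [cite: MadrasSlade1993, Definition 1.2.4; lane plumbing] -/
theorem gap_mono (U : Finset (Fin n)) (hU : U.card = u) {i i' : Fin u} (h : i ≤ i') : gap U hU i ≤ gap U hU i' := by
  have key : ∀ m : ℕ, ∀ hm : i.val + m < u, gap U hU i ≤ gap U hU ⟨i.val + m, hm⟩ := by
    intro m
    induction m with
    | zero => intro _; exact le_rfl
    | succ m ih =>
      intro hm
      have h1 := ih (by omega)
      have hs := gap_succ U hU ⟨i.val + m, by omega⟩ (by simp; omega)
      have heq : (⟨(⟨i.val + m, (by omega : i.val + m < u)⟩ : Fin u).val + 1, (by simp; omega)⟩ : Fin u) = ⟨i.val + (m + 1), hm⟩ :=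
        Fin.ext (by simp; omega)
      rw [heq] at hs
      by_cases hA : adjVec U hU ⟨i.val + m, by omega⟩ = true
      · rw [hs.1 hA]; exact h1
      · have := hs.2 (by simpa using hA); omega
  have hle : i.val ≤ i'.val := h
  have := key (i'.val - i.val) (by omega)
  have heq : (⟨i.val + (i'.val - i.val), (by omega : i.val + (i'.val - i.val) < u)⟩ : Fin u) = i' := Fin.ext (by simp; omega)
  rwa [heq] at this

/-- The gap function is strictly increasing across breaks. [cite: MadrasSlade1993, Definition 1.2.4; lane plumbing] -/
theorem gap_lt_of_break (U : Finset (Fin n)) (hU : U.card = u) {k i' : Fin u} (hk : adjVec U hU k = false) (h : k < i') :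
    gap U hU k < gap U hU i' := by
  have hk1 : k.val + 1 < u := lt_of_le_of_lt (Nat.succ_le_of_lt h) i'.isLt
  have hs := (gap_succ U hU k hk1).2 hk
  have hm := gap_mono U hU (i := ⟨k.val + 1, hk1⟩) (i' := i') (Fin.mk_le_mk.2 (Nat.succ_le_of_lt h) |>.trans le_rfl)
  omega

/-- ★ RANK LEMMA: the `r`-th break lies before position `i` iff `r < runIdx A i`. [cite: MadrasSlade1993, Definition 1.2.4; lane lemma] -/
theorem break_lt_iff (A : Fin u → Bool) {c : ℕ} (hB : (Finset.univ.filter fun k : Fin u => A k = false).card = c) (i : Fin u) (r : Fin c) :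
    (Finset.univ.filter fun k : Fin u => A k = false).orderEmbOfFin hB r < i ↔ r.val < runIdx A i := by
  classical
  set B := Finset.univ.filter fun k : Fin u => A k = false with hBdef
  set b := B.orderEmbOfFin hB with hb
  set T := Finset.univ.filter fun r' : Fin c => b r' < i with hT
  -- `#T = runIdx A i`
  have hcard : T.card = runIdx A i := by
    unfold runIdx
    rw [← Finset.card_map b.toEmbedding]
    congr 1
    ext k
    simp only [hT, Finset.mem_map, Finset.mem_filter, Finset.mem_univ, true_and, RelEmbedding.coe_toEmbedding]
    constructor
    · rintro ⟨r', hr', rfl⟩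
      exact ⟨hr', (Finset.mem_filter.1 (Finset.orderEmbOfFin_mem B hB r')).2⟩
    · rintro ⟨hk, hA⟩
      have hkB : k ∈ Set.range b := by rw [hb, Finset.range_orderEmbOfFin]; exact Finset.mem_filter.2 ⟨Finset.mem_univ _, hA⟩
      obtain ⟨r', rfl⟩ := hkB
      exact ⟨r', hk, rfl⟩
  rw [← hcard]
  constructor
  · intro h
    -- `Iic r ⊆ T`
    have hsub : Finset.Iic r ⊆ T := fun r' hr' =>
      Finset.mem_filter.2 ⟨Finset.mem_univ _, lt_of_le_of_lt (b.monotone (Finset.mem_Iic.1 hr')) h⟩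
    have := Finset.card_le_card hsub
    rw [Fin.card_Iic] at this
    omega
  · intro h
    by_contra hge
    push Not at hge
    -- `T ⊆ Iio r`
    have hsub : T ⊆ Finset.Iio r := fun r' hr' => by
      rw [Finset.mem_Iio]
      by_contra hle
      push Not at hle
      exact absurd (lt_of_le_of_lt (b.monotone hle) (Finset.mem_filter.1 hr').2) (not_lt.2 hge)
    have := Finset.card_le_card hsub
    rw [Fin.card_Iio] at this
    omega

/-- ★ The gap is constant from a position to the next break: `gap i = gap (b_{runIdx i})`. [cite: MadrasSlade1993, Definition 1.2.4; lane lemma] -/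
theorem gap_eq_gap_break (U : Finset (Fin n)) (hU : U.card = u) {c : ℕ}
    (hB : (Finset.univ.filter fun k : Fin u => adjVec U hU k = false).card = c) (i : Fin u) (hr : runIdx (adjVec U hU) i < c) :
    gap U hU ((Finset.univ.filter fun k : Fin u => adjVec U hU k = false).orderEmbOfFin hB ⟨runIdx (adjVec U hU) i, hr⟩) = gap U hU i := by
  classical
  set A := adjVec U hU with hA
  set B := Finset.univ.filter fun k : Fin u => A k = false with hBdef
  set b := B.orderEmbOfFin hB with hb
  set r₀ : Fin c := ⟨runIdx A i, hr⟩ with hr₀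
  -- `i ≤ b r₀`
  have hle : i ≤ b r₀ := by
    by_contra hlt
    push Not at hlt
    have := (break_lt_iff A hB i r₀).1 hlt
    exact lt_irrefl _ this
  -- no break in `[i, b r₀)`
  have hnobreak : ∀ k : Fin u, i ≤ k → k < b r₀ → A k = true := by
    intro k hik hkb
    by_contra hAk
    have hAk' : A k = false := by simpa using hAk
    have hkB : k ∈ Set.range b := by rw [hb, Finset.range_orderEmbOfFin]; exact Finset.mem_filter.2 ⟨Finset.mem_univ _, hAk'⟩
    obtain ⟨r, rfl⟩ := hkB
    have hrr : r < r₀ := b.lt_iff_lt.1 hkb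
    have := (break_lt_iff A hB i r).2 hrr
    exact absurd hik (not_le.2 this)
  -- the gap is constant on `[i, b r₀]`
  have hconst : ∀ m : ℕ, ∀ hm : i.val + m ≤ (b r₀).val, gap U hU ⟨i.val + m, by have := (b r₀).isLt; omega⟩ = gap U hU i := by
    intro m
    induction m with
    | zero => intro _; rfl
    | succ m ih =>
      intro hm
      have h1 := ih (by omega)
      have hkm : i.val + m + 1 < u := by have := (b r₀).isLt; omega
      have hlt : (⟨i.val + m, (by omega : i.val + m < u)⟩ : Fin u) < b r₀ := Fin.lt_def.2 (by simp only; omega)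
      have hs := (gap_succ U hU ⟨i.val + m, by omega⟩ hkm).1
        (hnobreak ⟨i.val + m, by omega⟩ (Fin.le_iff_val_le_val.2 (by simp)) hlt)
      have heq : (⟨(⟨i.val + m, (by omega : i.val + m < u)⟩ : Fin u).val + 1, hkm⟩ : Fin u) = ⟨i.val + (m + 1), by omega⟩ :=
        Fin.ext (by simp; omega)
      rw [heq] at hs
      rw [hs, h1]
  have hle' : i.val ≤ (b r₀).val := hle
  have h := hconst ((b r₀).val - i.val) (by omega)
  have heq : (⟨i.val + ((b r₀).val - i.val), (by have := (b r₀).isLt; omega)⟩ : Fin u) = b r₀ := Fin.ext (by simp; omega)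
  rw [heq] at h
  exact h

/-- ★★ SURJECTIVITY: every `u`-set of positions is the placed set of its break gaps. [cite: MadrasSlade1993, Definition 1.2.4; lane theorem] -/
theorem exists_placeSet_eq (U : Finset (Fin n)) (hU : U.card = u) :
    ∃ S : Finset ℕ, ∃ hS : S.card = breaks (adjVec U hU), ∃ hsub : S ⊆ Finset.range (n + 1 - u),
      placeSet (adjVec U hU) (fun h => adjVec_eq_false_of_last U hU ⟨u - 1, by omega⟩ (by simp; omega)) S hS hsub = U := by
  classical
  set A := adjVec U hU with hA
  have hlast : ∀ h : 0 < u, A ⟨u - 1, by omega⟩ = false := fun h => adjVec_eq_false_of_last U hU ⟨u - 1, by omega⟩ (by simp; omega)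
  set B := Finset.univ.filter fun k : Fin u => A k = false with hBdef
  have hB : B.card = breaks A := rfl
  set b := B.orderEmbOfFin hB with hb
  have hun : u ≤ n := card_le_of_card_eq U hU
  -- the slot set: gaps at the breaks
  set f : Fin (breaks A) → ℕ := fun r => gap U hU (b r) with hf
  have hfmono : StrictMono f := by
    intro r r' hrr
    exact gap_lt_of_break U hU (Finset.mem_filter.1 (Finset.orderEmbOfFin_mem B hB r)).2 (b.strictMono hrr)
  set S := Finset.univ.image f with hSdef
  have hS : S.card = breaks A := by
    rw [hSdef, Finset.card_image_of_injective _ hfmono.injective, Finset.card_univ, Fintype.card_fin]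
  have hsub : S ⊆ Finset.range (n + 1 - u) := by
    intro x hx
    rw [hSdef, Finset.mem_image] at hx
    obtain ⟨r, -, rfl⟩ := hx
    rw [Finset.mem_range]
    have h1 := orderEmbOfFin_val_add_le U hU (b r)
    have h2 := le_orderEmbOfFin_val U hU (b r)
    have h3 := (b r).isLt
    change gap U hU (b r) < n + 1 - u
    unfold gap
    omega
  have hslot : ∀ r, S.orderEmbOfFin hS r = f r := by
    intro r
    have := Finset.orderEmbOfFin_unique hS (f := f) (fun r => by rw [hSdef]; exact Finset.mem_image.2 ⟨r, Finset.mem_univ _, rfl⟩) hfmono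
    exact (congrFun this r).symm
  refine ⟨S, hS, hsub, ?_⟩
  -- the placement is the enumeration of `U`
  have hplace : ∀ i, place A hlast S hS i = (U.orderEmbOfFin hU i).val := by
    intro i
    unfold place
    rw [hslot, hf]
    simp only
    rw [gap_eq_gap_break U hU hB i, orderEmbOfFin_val_eq_gap_add U hU i]
  unfold placeSet
  conv_rhs => rw [← Finset.image_orderEmbOfFin_univ U hU]
  congr 1
  funext i
  exact Fin.ext (hplace i)

/-- ★★★ THE SLOT COUNT: the `u`-sets of positions of `Fin n` with adjacency vector `A` number `C(n + 1 − u, breaks A)` (for a vector whose last entry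
is a break; otherwise there are none). [cite: MadrasSlade1993, Definition 1.2.4; §1.1 eq. (1.1.8) p. 5; lane theorem] -/
theorem card_filter_adjVec_eq_choose (n u : ℕ) (A : Fin u → Bool) (hlast : ∀ h : 0 < u, A ⟨u - 1, by omega⟩ = false) :
    (Finset.univ.filter fun U : Finset (Fin n) => ∃ h : U.card = u, adjVec U h = A).card = (n + 1 - u).choose (breaks A) := by
  classical
  rw [← Finset.card_range (n + 1 - u), ← Finset.card_powersetCard (breaks A) (Finset.range (n + 1 - u))]
  symm
  refine Finset.card_bij (fun S hS => placeSet A hlast S (Finset.mem_powersetCard.1 hS).2 (Finset.mem_powersetCard.1 hS).1)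
    (fun S hS => ?_) (fun S hS S' hS' h => ?_) (fun U hU => ?_)
  · exact Finset.mem_filter.2 ⟨Finset.mem_univ _, card_placeSet A hlast S _ _, adjVec_placeSet A hlast S _ _⟩
  · exact placeSet_injective A hlast _ _ _ _ h
  · obtain ⟨-, hcard, hA⟩ := Finset.mem_filter.1 hU
    subst hA
    obtain ⟨S, hS, hsub, hUS⟩ := exists_placeSet_eq U hcard
    exact ⟨S, Finset.mem_powersetCard.2 ⟨hsub, hS⟩, hUS⟩

end Slots

/-! ## α-IV: ASSEMBLY — the bad-word count of the slice is `2^n` times a polynomial in `n` -/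

section Assembly

variable {u : ℕ}

open Classical in
/-- The BAD SLICE `T_j(n)`: canonical step words of length `n` with `n − j` axes, reversal-free, with a repeat (the count in the hypothesis of
`exists_polynomial_count_topFour_of_card_canonical`, `j = 3`). [cite: MadrasSlade1993, Definition 1.2.4; §1.1 eq. (1.1.8) p. 5; lane tool notion] -/
def badSlice (j n : ℕ) : Finset (Word n n) :=
  Finset.univ.filter fun τ => canon τ = τ ∧ numAxes τ + j = n ∧ NoRev τ ∧ ∃ i ≤ n, ∃ i' ≤ n, i < i' ∧ wordPos τ i = wordPos τ i'

/-- A VALID adjacency vector: the last entry is a break. [cite: MadrasSlade1993, Definition 1.2.4; lane tool notion] -/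
def AdjValid (A : Fin u → Bool) : Prop := ∀ h : 0 < u, A ⟨u - 1, by omega⟩ = false

open Classical in
/-- The SLOT COUNT: `u`-sets of positions of `Fin n` with adjacency vector `A`. [cite: MadrasSlade1993, Definition 1.2.4; lane tool notion] -/
def slotCount (n u : ℕ) (A : Fin u → Bool) : ℕ := (Finset.univ.filter fun U : Finset (Fin n) => ∃ h : U.card = u, adjVec U h = A).card

open Classical in
/-- The slot count is `C(n + 1 − u, breaks A)` for valid `A` and `0` otherwise. [cite: MadrasSlade1993, Definition 1.2.4; lane lemma] -/
theorem slotCount_eq (n u : ℕ) (A : Fin u → Bool) : slotCount n u A = if AdjValid A then (n + 1 - u).choose (breaks A) else 0 := by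
  unfold slotCount
  split_ifs with hv
  · exact card_filter_adjVec_eq_choose n u A hv
  · rw [Finset.card_eq_zero, Finset.filter_eq_empty_iff]
    rintro U - ⟨hU, hA⟩
    apply hv
    intro hu
    rw [← hA]
    exact adjVec_eq_false_of_last U hU ⟨u - 1, by omega⟩ (by simp; omega)

/-- There is no `u`-set of positions with `u > n`. [cite: MadrasSlade1993, Definition 1.2.4; lane plumbing] -/
theorem slotCount_eq_zero_of_lt (n u : ℕ) (A : Fin u → Bool) (h : n < u) : slotCount n u A = 0 := by
  classical
  unfold slotCount
  rw [Finset.card_eq_zero, Finset.filter_eq_empty_iff]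
  rintro U - ⟨hU, -⟩
  have := card_le_of_card_eq U hU
  omega

/-- The bad slice is partitioned by the repeat set: its `U`-part is the fibre. [cite: MadrasSlade1993, Definition 1.2.4; lane plumbing] -/
theorem badSlice_filter_repSet (j n : ℕ) (U : Finset (Fin n)) :
    (badSlice j n).filter (fun τ => repSet τ = U) = fibre j U := by
  classical
  unfold badSlice fibre
  ext τ
  simp only [Finset.mem_filter, Finset.mem_univ, true_and, and_assoc]

/-- `#T_j(n) = Σ_U #fibre_j(U)`. [cite: MadrasSlade1993, Definition 1.2.4; lane lemma] -/
theorem card_badSlice_eq_sum_fibre (j n : ℕ) : (badSlice j n).card = ∑ U : Finset (Fin n), (fibre j U).card := by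
  classical
  rw [Finset.card_eq_sum_card_fiberwise (f := fun τ : Word n n => repSet τ) (t := Finset.univ) (fun _ _ => Finset.mem_coe.2 (Finset.mem_univ _))]
  exact Finset.sum_congr rfl fun U _ => by rw [badSlice_filter_repSet]

/-- The shape class is empty for `u > 2j`: a word all of whose positions are repeated has at most `u/2` axes. [cite: MadrasSlade1993, Definition 1.2.4; lane lemma] -/
theorem shapeClass_eq_empty (j u : ℕ) (A : Fin u → Bool) (h : 2 * j < u) : shapeClass j u A = ∅ := by
  classical
  unfold shapeClass
  rw [Finset.filter_eq_empty_iff]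
  rintro κ - ⟨-, hnum, hrep, -⟩
  have hall : repSet κ = Finset.univ := Finset.eq_univ_of_forall fun i => mem_repSet.2 (hrep i)
  have h1 := card_repSet_le_two_mul_sub κ
  rw [hall, Finset.card_univ, Fintype.card_fin] at h1
  omega

/-- The fibre over a repeat set with more than `2j` members is empty. [cite: MadrasSlade1993, Definition 1.2.4; lane plumbing] -/
theorem card_fibre_eq_zero_of_lt (j : ℕ) (U : Finset (Fin n)) (h : 2 * j < U.card) : (fibre j U).card = 0 := by
  rw [card_fibre j U rfl, shapeClass_eq_empty j _ _ h, Finset.card_empty, zero_mul]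

open Classical in
/-- ★★ THE REGROUPED COUNT: `#T_j(n) = Σ_{u ≤ 2j} Σ_{A} slotCount(n, u, A) · #shapeClass_j(u, A) · 2^{n−u}`.
[cite: MadrasSlade1993, Definition 1.2.4; §1.1 eq. (1.1.8) p. 5; lane theorem] -/
theorem card_badSlice_eq_sum (j n : ℕ) :
    (badSlice j n).card = ∑ u ∈ Finset.range (2 * j + 1), ∑ A : Fin u → Bool, slotCount n u A * ((shapeClass j u A).card * 2 ^ (n - u)) := by
  rw [card_badSlice_eq_sum_fibre]
  -- restrict to `|U| ≤ 2j`
  have hrestrict : ∑ U : Finset (Fin n), (fibre j U).card =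
      ∑ U ∈ Finset.univ.filter (fun U : Finset (Fin n) => U.card ≤ 2 * j), (fibre j U).card := by
    rw [Finset.sum_filter]
    refine Finset.sum_congr rfl fun U _ => ?_
    split_ifs with h
    · rfl
    · exact card_fibre_eq_zero_of_lt j U (by omega)
  rw [hrestrict]
  -- group by `|U|`
  rw [← Finset.sum_fiberwise_of_maps_to (g := fun U : Finset (Fin n) => U.card) (t := Finset.range (2 * j + 1))
    (fun U hU => Finset.mem_range.2 (Nat.lt_succ_of_le (Finset.mem_filter.1 hU).2))]
  refine Finset.sum_congr rfl fun u hu => ?_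
  have hu' : u ≤ 2 * j := Nat.le_of_lt_succ (Finset.mem_range.1 hu)
  have hset : (Finset.univ.filter fun U : Finset (Fin n) => U.card ≤ 2 * j).filter (fun U => U.card = u) =
      Finset.univ.filter fun U : Finset (Fin n) => U.card = u := by
    ext U; simp only [Finset.mem_filter, Finset.mem_univ, true_and]; constructor
    · exact fun h => h.2
    · exact fun h => ⟨by omega, h⟩
  rw [hset]
  -- group by the adjacency vector
  set ψ : Finset (Fin n) → (Fin u → Bool) := fun U => if h : U.card = u then adjVec U h else fun _ => false with hψ
  rw [← Finset.sum_fiberwise (s := Finset.univ.filter fun U : Finset (Fin n) => U.card = u) (g := ψ)]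
  refine Finset.sum_congr rfl fun A _ => ?_
  have hfib : ((Finset.univ.filter fun U : Finset (Fin n) => U.card = u).filter fun U => ψ U = A) =
      Finset.univ.filter fun U : Finset (Fin n) => ∃ h : U.card = u, adjVec U h = A := by
    ext U
    simp only [Finset.mem_filter, Finset.mem_univ, true_and, hψ]
    constructor
    · rintro ⟨hU, hA⟩
      rw [dif_pos hU] at hA
      exact ⟨hU, hA⟩
    · rintro ⟨hU, hA⟩
      rw [dif_pos hU]
      exact ⟨hU, hA⟩
  rw [Finset.sum_congr rfl (g := fun _ => (shapeClass j u A).card * 2 ^ (n - u)) ?_, Finset.sum_const, smul_eq_mul, hfib]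
  · rfl
  · intro U hU
    rw [Finset.mem_filter, Finset.mem_filter] at hU
    obtain ⟨⟨-, hcard⟩, hA⟩ := hU
    rw [hψ] at hA
    simp only [dif_pos hcard] at hA
    subst hcard
    rw [card_fibre j U rfl, hA]

/-! ### The polynomial -/

/-- A valid adjacency vector of positive length has at least one break. [cite: MadrasSlade1993, Definition 1.2.4; lane plumbing] -/
theorem breaks_pos_of_valid {A : Fin u → Bool} (hv : AdjValid A) (hu : 0 < u) : 0 < breaks A := by
  unfold breaks
  exact Finset.card_pos.2 ⟨⟨u - 1, by omega⟩, Finset.mem_filter.2 ⟨Finset.mem_univ _, hv hu⟩⟩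

open Classical Polynomial in
/-- The SYMBOL POLYNOMIAL `R_j(X) = Σ_{u ≤ 2j} Σ_{A valid} #shapeClass_j(u, A) · 2^{−u} · C(X + 1 − u, breaks A)` (binomial polynomials via
`descPochhammer`). [cite: MadrasSlade1993, §1.1 eq. (1.1.8) p. 5; lane tool notion] -/
def symbolPoly (j : ℕ) : Polynomial ℚ :=
  ∑ u ∈ Finset.range (2 * j + 1), ∑ A : Fin u → Bool,
    if AdjValid A then Polynomial.C (((shapeClass j u A).card : ℚ) * (1 / 2) ^ u / ((breaks A).factorial : ℚ)) *
      (descPochhammer ℚ (breaks A)).comp (Polynomial.X + Polynomial.C ((1 : ℚ) - u)) else 0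

open Classical Polynomial in
/-- Evaluating one term of the symbol polynomial at `n ≥ u − 1`: `#shapeClass · 2^{−u} · C(n + 1 − u, breaks)`.
[cite: MadrasSlade1993, §1.1 eq. (1.1.8) p. 5; lane plumbing] -/
theorem eval_symbolPoly_term (j n : ℕ) (A : Fin u → Bool) (hun : u ≤ n + 1) :
    (Polynomial.C (((shapeClass j u A).card : ℚ) * (1 / 2) ^ u / ((breaks A).factorial : ℚ)) *
        (descPochhammer ℚ (breaks A)).comp (Polynomial.X + Polynomial.C ((1 : ℚ) - u))).eval (n : ℚ) =
      ((shapeClass j u A).card : ℚ) * (1 / 2) ^ u * ((n + 1 - u).choose (breaks A) : ℚ) := by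
  rw [Polynomial.eval_mul, Polynomial.eval_C, Polynomial.eval_comp, Polynomial.eval_add, Polynomial.eval_X, Polynomial.eval_C]
  have hcast : ((n : ℚ) + (1 - (u : ℚ))) = ((n + 1 - u : ℕ) : ℚ) := by
    rw [Nat.cast_sub hun]; push_cast; ring
  rw [hcast, descPochhammer_eval_eq_descFactorial, Nat.descFactorial_eq_factorial_mul_choose]
  have hf : ((breaks A).factorial : ℚ) ≠ 0 := by exact_mod_cast (breaks A).factorial_ne_zero
  push_cast
  field_simp

open Classical in
/-- ★★★ SYMBOL POLYNOMIALITY — THE BAD-WORD COUNT IS `2^n` TIMES A POLYNOMIAL IN `n`: for every `j` and every `n ≥ 2j − 1`,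
`#T_j(n) = 2^n · R_j(n)` with `R_j = symbolPoly j ∈ ℚ[X]` (so the canonical-sign-normalised count `T_j(n)/2^{n−j}` is the polynomial `2^j R_j(n)`).
This is the polynomiality-in-`n` of the lane's `1/d`-symbol censuses (`j = 3`: CAR M's `card_badCanonical`; `j = 4`: the count behind (L1′)).
[cite: MadrasSlade1993, §1.1 eq. (1.1.8) p. 5; Definition 1.2.4] [cite: ClisbyLiangSlade2007, §3.3 eqs. (29)/(31); lane theorem] -/
theorem card_badSlice_eq_pow_mul_eval (j n : ℕ) (hn : 2 * j ≤ n + 1) :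
    ((badSlice j n).card : ℚ) = 2 ^ n * (symbolPoly j).eval (n : ℚ) := by
  rw [card_badSlice_eq_sum]
  unfold symbolPoly
  rw [Polynomial.eval_finsetSum, Finset.mul_sum]
  push_cast
  refine Finset.sum_congr rfl fun u hu => ?_
  have hu2 : u ≤ 2 * j := Nat.le_of_lt_succ (Finset.mem_range.1 hu)
  have hun : u ≤ n + 1 := hu2.trans hn
  rw [Polynomial.eval_finsetSum, Finset.mul_sum]
  refine Finset.sum_congr rfl fun A _ => ?_
  rw [slotCount_eq]
  by_cases hv : AdjValid A
  · rw [if_pos hv, if_pos hv, eval_symbolPoly_term j n A hun]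
    by_cases hle : u ≤ n
    · have h2 : (2 : ℚ) ^ n = 2 ^ (n - u) * 2 ^ u := by rw [← pow_add, Nat.sub_add_cancel hle]
      rw [h2]
      have : ((1 : ℚ) / 2) ^ u * 2 ^ u = 1 := by rw [← mul_pow]; norm_num
      calc ((n + 1 - u).choose (breaks A) : ℚ) * (((shapeClass j u A).card : ℚ) * 2 ^ (n - u))
          = 2 ^ (n - u) * (((1 : ℚ) / 2) ^ u * 2 ^ u) * (((shapeClass j u A).card : ℚ) * ((n + 1 - u).choose (breaks A) : ℚ)) := by
            rw [this]; ring
        _ = 2 ^ (n - u) * 2 ^ u * (((shapeClass j u A).card : ℚ) * (1 / 2) ^ u * ((n + 1 - u).choose (breaks A) : ℚ)) := by ring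
    · -- `u = n + 1`: no `u`-subset of `Fin n`, and `C(0, breaks) = 0`
      have hu1 : u = n + 1 := by omega
      have hb := breaks_pos_of_valid hv (by omega)
      have hc : (n + 1 - u).choose (breaks A) = 0 := by
        have : n + 1 - u = 0 := by omega
        rw [this, Nat.choose_eq_zero_of_lt hb]
      rw [hc]
      push_cast
      ring
  · rw [if_neg hv, if_neg hv]
    simp

open Classical in
/-- ★★★ SYMBOL POLYNOMIALITY IN THE LANE'S `hT` FORM: for `n = l + j` with `j ≤ l + 1`, the canonical reversal-free words of length `n` with `l` axes
and a repeat number `2^{l+j} · R_j(l + j)`. (`j = 3`: compare `WordTypes.card_badCanonical`; `j = 4`: the count behind the fifth coefficient (L1′).)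
[cite: MadrasSlade1993, §1.1 eq. (1.1.8) p. 5; Definition 1.2.4; lane theorem] -/
theorem card_canonical_bad_eq_pow_mul_eval (j l : ℕ) (hjl : j ≤ l + 1) :
    (((Finset.univ.filter fun τ : Word (l + j) (l + j) => canon τ = τ ∧ numAxes τ = l ∧
        (∀ p : Fin (l + j), ∀ hp : p.val + 1 < l + j, τ ⟨p.val + 1, hp⟩ ≠ ((τ p).1, !(τ p).2)) ∧
        (∃ i ≤ l + j, ∃ i' ≤ l + j, i < i' ∧ wordPos τ i = wordPos τ i')).card : ℕ) : ℚ) =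
      2 ^ (l + j) * (symbolPoly j).eval ((l + j : ℕ) : ℚ) := by
  rw [← card_badSlice_eq_pow_mul_eval j (l + j) (by omega)]
  congr 2
  unfold badSlice
  refine Finset.filter_congr fun τ _ => ?_
  constructor
  · rintro ⟨h1, h2, h3, h4⟩; exact ⟨h1, by omega, h3, h4⟩
  · rintro ⟨h1, h2, h3, h4⟩; exact ⟨h1, by omega, h3, h4⟩

/-- The number of breaks is at most the length. [cite: MadrasSlade1993, Definition 1.2.4; lane plumbing] -/
theorem breaks_le (A : Fin u → Bool) : breaks A ≤ u := by
  unfold breaks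
  exact (Finset.card_le_univ _).trans (by simp)

open Classical Polynomial in
/-- ★ The symbol polynomial has degree at most `2j`. [cite: MadrasSlade1993, §1.1 eq. (1.1.8) p. 5; lane lemma] -/
theorem natDegree_symbolPoly_le (j : ℕ) : (symbolPoly j).natDegree ≤ 2 * j := by
  unfold symbolPoly
  refine Polynomial.natDegree_sum_le_of_forall_le _ _ fun u hu => ?_
  have hu2 : u ≤ 2 * j := Nat.le_of_lt_succ (Finset.mem_range.1 hu)
  refine Polynomial.natDegree_sum_le_of_forall_le _ _ fun A _ => ?_
  split_ifs with hv
  · refine (Polynomial.natDegree_C_mul_le _ _).trans ?_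
    refine Polynomial.natDegree_comp_le.trans ?_
    rw [descPochhammer_natDegree, Polynomial.natDegree_X_add_C, mul_one]
    exact (breaks_le A).trans hu2
  · simp

/-- ★★★ SYMBOL POLYNOMIALITY (existential form): for every `j` there is `R_j ∈ ℚ[X]` of degree `≤ 2j` with `#T_j(n) = 2^n · R_j(n)` for all
`n ≥ 2j − 1` — the polynomiality IN `n` of the bad-word census behind the `1/d`-symbol `[d^{n−j}] c_n(ℤ^d)` (FINDING-ZD-SYMBOL-POLYNOMIALITY §1;
the polynomiality half of the lane's STRUCTURE CONJECTURE, FINDING-ZD-FOURTH-SYMBOL §8, with its threshold).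
[cite: MadrasSlade1993, §1.1 eq. (1.1.8) p. 5; Definition 1.2.4] [cite: ClisbyLiangSlade2007, §3.3 eqs. (29)/(31); lane theorem] -/
theorem exists_polynomial_card_badSlice (j : ℕ) :
    ∃ R : Polynomial ℚ, R.natDegree ≤ 2 * j ∧ ∀ n : ℕ, 2 * j ≤ n + 1 → ((badSlice j n).card : ℚ) = 2 ^ n * R.eval (n : ℚ) :=
  ⟨symbolPoly j, natDegree_symbolPoly_le j, fun n hn => card_badSlice_eq_pow_mul_eval j n hn⟩

end Assembly

end WordTypes

end Literature.Probability.RandomPlanarGeometry.SAW.Zd
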